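import Summits.AtomisticToContinuum.HydrodynamicLimit.Theses.BoxDissipativeWeakStrong
import Summits.AtomisticToContinuum.HydrodynamicLimit.Theorems.BoxDissipativeWeakStrongDefs
import Summits.AtomisticToContinuum.HydrodynamicLimit.Theorems.BoxDissipativeWeakStrongEntropyAdmissibilityStubEntropyModulus
import Summits.AtomisticToContinuum.HydrodynamicLimit.Theorems.BoxDissipativeWeakStrongEntropyAdmissibilityStubInitialEntropyLLN
import Summits.AtomisticToContinuum.HydrodynamicLimit.Theorems.BoxDissipativeWeakStrongEntropyAdmissibilityStubDynPartIntegrable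

/-!
# Crux `EntropyAdmissibility` (stmt-AtomisticToContinuum-9903), line `registered` — stub `stub_meanEntropyDeficitNecessary`

The OPEN heart of the line is the registered stub S1b `stub_meanEntropyDeficit` (the annealed, clamp-renormalised
LOCAL second law in mean: `∀ ε > 0`, eventually `E_{P_N}[A_N] + B ≤ ε`). This file proves that S1b is NECESSARY
for the crux: the crux decl `BoxDissipativeWeakStrong.EntropyAdmissibility` implies S1b, given the LANDED statics
(S0 = `EABirthS0b.stub_initialEntropyLLN_of_modulus EABirthS0a.stub_entropyModulus`: `E|B_N − B| → 0`) and the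
LANDED integrability of the dynamic part (S1a = `EABirthS1a.stub_dynPartIntegrable`). Hence the reshape of the
line loses nothing on the S1 side: the crux is EQUIVALENT, modulo landed theorems and the fluctuation stub S2, to S1b.

Proof: on a probability space, `E[A_N] + B = E[A_N + B_N] + E[B − B_N] ≤ E[(A_N + B_N)⁺] + E|B_N − B|`
(`eventually_integral_add_const_le`); the crux says `E[(A_N + B_N)⁺] → 0` (its `∫⁻ ofReal` is the positive part),
S0 says `E|B_N − B| → 0`; integrability of `A_N` is S1a and of `B_N = initPart` is `integrable_initPart`
(bounded measurable: the landed S1a toolbox `measurable_statEntropy`, `measurable_statBdry`, `abs_statBdry_le`).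
The quantifier bookkeeping (`ηc`, `σ₀` as minima) mirrors the skeleton's composition `EntropyAdmissibility_of`.

References: J. Březina, E. Feireisl, J. Math. Soc. Japan 70 (2018), Def. 2.9; H. Spohn (1991), Part I Ch. 3.
-/

noncomputable section

open MeasureTheory Filter Set
open scoped ENNReal Topology

namespace Summit.AtomisticToContinuum.HydrodynamicLimit.Theorems.EABirthS1bNec

open Literature.MathematicalPhysics.KineticTheory
open Literature.Analysis.FluidPDE.CompressibleEuler (clamp)
open Summit.AtomisticToContinuum.HydrodynamicLimit.Theses
open Summit.AtomisticToContinuum.HydrodynamicLimit.Theorems.BDWS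
open Literature.Analysis.FluidPDE (Config HardSphereFlow)
open Literature.Analysis.FunctionSpaces

/-! ## An abstract one-sided squeeze -/

/-- **One-sided recovery of the mean inequality.** On probability spaces `(Ω_N, P_N)`: if `A_N`, `B_N` are
integrable, `E|B_N − c| → 0` and `E[(A_N + B_N)⁺] → 0` (outer integrals `∫⁻ ofReal`), then for every `ε > 0`,
eventually `E[A_N] + c ≤ ε`. -/
theorem eventually_integral_add_const_le {Ω : ℕ → Type*} [∀ N, MeasurableSpace (Ω N)]
    (P : ∀ N, Measure (Ω N)) [hP : ∀ N, IsProbabilityMeasure (P N)] (A B : ∀ N, Ω N → ℝ) (c : ℝ)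
    (hA : ∀ N, Integrable (A N) (P N)) (hB : ∀ N, Integrable (B N) (P N))
    (h0 : Tendsto (fun N => ∫⁻ z, ENNReal.ofReal |B N z - c| ∂P N) atTop (𝓝 0))
    (h2 : Tendsto (fun N => ∫⁻ z, ENNReal.ofReal (A N z + B N z) ∂P N) atTop (𝓝 0)) :
    ∀ ε : ℝ, 0 < ε → ∀ᶠ N in atTop, (∫ z, A N z ∂P N) + c ≤ ε := by
  intro ε hε
  have h0' : Tendsto (fun N => (∫⁻ z, ENNReal.ofReal |B N z - c| ∂P N).toReal) atTop (𝓝 0) := by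
    have := (ENNReal.tendsto_toReal ENNReal.zero_ne_top).comp h0
    simpa only [Function.comp_def, ENNReal.toReal_zero] using this
  have h2' : Tendsto (fun N => (∫⁻ z, ENNReal.ofReal (A N z + B N z) ∂P N).toReal) atTop (𝓝 0) := by
    have := (ENNReal.tendsto_toReal ENNReal.zero_ne_top).comp h2
    simpa only [Function.comp_def, ENNReal.toReal_zero] using this
  have e0 := (tendsto_order.1 h0').2 (ε / 2) (half_pos hε)
  have e2 := (tendsto_order.1 h2').2 (ε / 2) (half_pos hε)
  filter_upwards [e0, e2] with N hN0 hN2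
  have hAB : Integrable (fun z => A N z + B N z) (P N) := (hA N).add (hB N)
  have hcB : Integrable (fun z => c - B N z) (P N) := (integrable_const c).sub (hB N)
  -- `E[A] + c = E[A + B] + E[c − B]`
  have hsplit : (∫ z, A N z ∂P N) + c = (∫ z, (A N z + B N z) ∂P N) + ∫ z, (c - B N z) ∂P N := by
    rw [integral_add (hA N) (hB N), integral_sub (integrable_const c) (hB N), integral_const, smul_eq_mul,
      probReal_univ, one_mul]
    ring
  -- `E[A + B] ≤ E[(A + B)⁺]`
  have h1 : (∫ z, (A N z + B N z) ∂P N) ≤ (∫⁻ z, ENNReal.ofReal (A N z + B N z) ∂P N).toReal := by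
    rw [integral_eq_lintegral_pos_part_sub_lintegral_neg_part hAB]
    exact sub_le_self _ ENNReal.toReal_nonneg
  -- `E[c − B] ≤ E|B − c|`
  have h3 : (∫ z, (c - B N z) ∂P N) ≤ (∫⁻ z, ENNReal.ofReal |B N z - c| ∂P N).toReal := by
    have habs : Integrable (fun z => |B N z - c|) (P N) := ((hB N).sub (integrable_const c)).abs
    calc (∫ z, (c - B N z) ∂P N) ≤ ∫ z, |B N z - c| ∂P N :=
          integral_mono hcB habs fun z => by
            have := neg_abs_le (B N z - c)
            linarith
      _ = (∫⁻ z, ENNReal.ofReal |B N z - c| ∂P N).toReal :=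
          integral_eq_lintegral_of_nonneg_ae (Eventually.of_forall fun z => abs_nonneg _)
            habs.aestronglyMeasurable
  linarith

/-! ## Integrability of the initial part -/

/-- The initial part `B_N = initPart` is the space integral of the static boundary integrand of the landed S1a
toolbox at time `0` (definitional). -/
theorem initPart_eq_integral_statBdry (σ η₁ : ℝ) (ℓ : ℕ → ℝ) (Φ : FlowFamily σ) (a b : ℝ) (φ : ℝ → T3 → ℝ)
    (N : ℕ) (z : Config (N + 1) (Fin 3) T3) :
    initPart σ η₁ ℓ Φ a b φ N z = ∫ x, EABirthS1a.statBdry σ η₁ (ℓ N) a b (φ 0) ((Φ N).flow 0 z) x :=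
  rfl

/-- **The initial part is integrable** under any finite measure on phase space: it is a bounded, measurable
function of the configuration (box density `≤ ℓ⁻³`, clamp `≤ |a| ∨ |b|`, continuous `φ(0,·)` on the compact torus;
measurability through the landed `EABirthS1a.measurable_statEntropy` / `measurable_statBdry`, which need the excess
free energy continuous on `[0, η₀) ⊇ [0, η₁]`). -/
theorem integrable_initPart {η₀ σ η₁ T a b : ℝ} (hcont : ContinuousOn hsExcessFreeEnergy (Ico 0 η₀))
    (hσ : 0 ≤ σ) (hη₁ : 0 ≤ η₁) (hη₁c : η₁ < η₀) {ℓ : ℕ → ℝ} {N : ℕ} (Φ : FlowFamily σ) (hℓ : 0 < ℓ N)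
    (hT : 0 < T) (hab : a ≤ b) {φ : ℝ → T3 → ℝ} (hφ : Torus.IsSmoothSpaceTimeOn (Ico 0 T) φ)
    (P : Measure (Config (N + 1) (Fin 3) T3)) [IsFiniteMeasure P] :
    Integrable (initPart σ η₁ ℓ Φ a b φ N) P := by
  have h0T : (0 : ℝ) ∈ Ico 0 T := ⟨le_rfl, hT⟩
  have hφc : Continuous (φ 0) := (hφ.isSmooth_slice h0T).continuous
  obtain ⟨C, hC0, hC⟩ := exists_forall_abs_le_of_continuous hφc
  have hG := EABirthS1a.measurable_statEntropy (N := N) hcont hσ hη₁ hη₁c hℓ.le a b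
  have hSB := EABirthS1a.measurable_statBdry hG hφc.measurable
  have hSM : StronglyMeasurable fun z : Config (N + 1) (Fin 3) T3 =>
      ∫ x, EABirthS1a.statBdry σ η₁ (ℓ N) a b (φ 0) ((Φ N).flow 0 z) x :=
    ((hSB.comp ((((Φ N).measurable_flow 0).comp measurable_fst).prodMk measurable_snd)).stronglyMeasurable
      (α := Config (N + 1) (Fin 3) T3 × T3)).integral_prod_right'
  have hbound : ∀ z, ‖initPart σ η₁ ℓ Φ a b φ N z‖ ≤ (ℓ N ^ 3)⁻¹ * max |a| |b| * C := by
    intro z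
    rw [initPart_eq_integral_statBdry]
    have hpt : ∀ x, ‖EABirthS1a.statBdry σ η₁ (ℓ N) a b (φ 0) ((Φ N).flow 0 z) x‖ ≤ (ℓ N ^ 3)⁻¹ * max |a| |b| * C :=
      fun x => by
        rw [Real.norm_eq_abs]
        exact EABirthS1a.abs_statBdry_le hab hℓ.le (by rw [Real.norm_eq_abs]; exact hC x) _
    calc ‖∫ x, EABirthS1a.statBdry σ η₁ (ℓ N) a b (φ 0) ((Φ N).flow 0 z) x‖
        ≤ ((ℓ N ^ 3)⁻¹ * max |a| |b| * C) * (volume : Measure T3).real univ :=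
          norm_integral_le_of_norm_le_const (Eventually.of_forall hpt)
      _ = (ℓ N ^ 3)⁻¹ * max |a| |b| * C := by rw [probReal_univ, mul_one]
  exact (integrable_const ((ℓ N ^ 3)⁻¹ * max |a| |b| * C)).mono' hSM.aestronglyMeasurable
    (Eventually.of_forall hbound)

/-! ## The stub: the crux implies S1b -/

/-- **Signature of the registered stub `stub_meanEntropyDeficitNecessary`**: the crux decl implies S1b (verbatim the
skeleton's `Sig.stub_meanEntropyDeficit`) — necessity of the annealed local entropy deficit bound. -/
def Sig.stub_meanEntropyDeficitNecessary : Prop :=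
  BoxDissipativeWeakStrong.EntropyAdmissibility →
  (BoxDissipativeWeakStrong.HsEosLowDensity →
    ∃ ηc : ℝ, 0 < ηc ∧ ∀ η₁ : ℝ, 0 < η₁ → η₁ < ηc →
      ∀ (a₀ θ₀ : T3 → ℝ) (u₀ : T3 → V3), Continuous a₀ → Continuous θ₀ → Continuous u₀ →
        (∀ x, 0 < a₀ x) → (∀ x, 0 < θ₀ x) →
        ∃ σ₀ : ℝ, 0 < σ₀ ∧ ∀ σ : ℝ, 0 < σ → σ < σ₀ →
          ∀ (T : ℝ) (ρ θ : ℝ → T3 → ℝ) (u : ℝ → T3 → V3), IsHardSphereEulerSolution σ T ρ u θ →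
            (∀ t ∈ Ico 0 T, ∀ x, ρ t x * σ ^ 3 ≤ η₁ / 2) →
            ∀ Φ : FlowFamily σ,
              TendstoHydroFieldsAt (fun N => localGibbsLaw σ a₀ u₀ θ₀ N (Φ N)) Φ ρ u θ 0 →
              ∀ ℓ : ℕ → ℝ, (∀ N, 0 < ℓ N ∧ ℓ N ≤ 1) → Tendsto ℓ atTop (𝓝 0) →
                Tendsto (fun N : ℕ => ℓ N ^ 3 * ((N : ℝ) + 1)) atTop atTop →
                ∀ τ ∈ Ico 0 T, ∀ a b : ℝ, a < b → ∀ φ : ℝ → T3 → ℝ,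
                  Literature.Analysis.FunctionSpaces.Torus.IsSmoothSpaceTimeOn (Ico 0 T) φ →
                  (∀ t ∈ Icc 0 τ, ∀ x, 0 ≤ φ t x) →
                  ∀ ε : ℝ, 0 < ε → ∀ᶠ N : ℕ in atTop,
                    (∫ z, dynPart σ η₁ T ℓ Φ τ a b φ N z ∂(localGibbsLaw σ a₀ u₀ θ₀ N (Φ N))) +
                        initLimit σ η₁ ρ θ a b φ ≤ ε)

/-- **Registered stub `stub_meanEntropyDeficitNecessary`** (crux stmt-AtomisticToContinuum-9903, line `registered`):
the crux `EntropyAdmissibility` implies the open heart S1b, given the landed S0 (initial entropy LLN) and S1a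
(integrability of the dynamic part). Thresholds: `ηc := min (η₀ of the EOS fact) (min ηS0 (min ηS1a ηcrux))`,
`σ₀ := min (min σS0 (min σS1a σcrux)) (1/2)`. -/
theorem stub_meanEntropyDeficitNecessary : Sig.stub_meanEntropyDeficitNecessary := by
  intro hEA hEos
  have hS0 := EABirthS0b.stub_initialEntropyLLN_of_modulus EABirthS0a.stub_entropyModulus hEos
  have hS1a := EABirthS1a.stub_dynPartIntegrable hEos
  have hC := hEA hEos
  obtain ⟨ηE, hηE, F, hFan, hFeq, -⟩ := hEos
  have hcont : ContinuousOn hsExcessFreeEnergy (Ico 0 ηE) :=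
    (hFan.continuousOn.mono fun η hη => ⟨(neg_lt_zero.2 hηE).trans_le hη.1, hη.2⟩).congr hFeq
  obtain ⟨η0, hη0, H0⟩ := hS0
  obtain ⟨η1, hη1, H1⟩ := hS1a
  obtain ⟨η2, hη2, H2⟩ := hC
  refine ⟨min ηE (min η0 (min η1 η2)), lt_min hηE (lt_min hη0 (lt_min hη1 hη2)), ?_⟩
  intro η₁ hη₁ hη₁c a₀ θ₀ u₀ ha hθ hu ha0 hθ0
  have hη₁E : η₁ < ηE := lt_of_lt_of_le hη₁c (min_le_left _ _)
  have hη₁0 : η₁ < η0 := lt_of_lt_of_le hη₁c ((min_le_right _ _).trans (min_le_left _ _))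
  have hη₁1 : η₁ < η1 :=
    lt_of_lt_of_le hη₁c ((min_le_right _ _).trans ((min_le_right _ _).trans (min_le_left _ _)))
  have hη₁2 : η₁ < η2 :=
    lt_of_lt_of_le hη₁c ((min_le_right _ _).trans ((min_le_right _ _).trans (min_le_right _ _)))
  obtain ⟨σ0, hσ0, G0⟩ := H0 η₁ hη₁ hη₁0 a₀ θ₀ u₀ ha hθ hu ha0 hθ0
  obtain ⟨σ1, hσ1, G1⟩ := H1 η₁ hη₁ hη₁1 a₀ θ₀ u₀ ha hθ hu ha0 hθ0
  obtain ⟨σ2, hσ2, G2⟩ := H2 η₁ hη₁ hη₁2 a₀ θ₀ u₀ ha hθ hu ha0 hθ0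
  refine ⟨min (min σ0 (min σ1 σ2)) (1 / 2), lt_min (lt_min hσ0 (lt_min hσ1 hσ2)) one_half_pos, ?_⟩
  intro σ hσ hσlt T ρ θ u hsol hguard Φ hLLN ℓ hℓ hℓ0 hℓ3 τ hτ a b hab φ hφ hφ0
  have hσm : σ < min σ0 (min σ1 σ2) := lt_of_lt_of_le hσlt (min_le_left _ _)
  have hσ0' : σ < σ0 := lt_of_lt_of_le hσm (min_le_left _ _)
  have hσ1' : σ < σ1 := lt_of_lt_of_le hσm ((min_le_right _ _).trans (min_le_left _ _))
  have hσ2' : σ < σ2 := lt_of_lt_of_le hσm ((min_le_right _ _).trans (min_le_right _ _))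
  have hσhalf : σ ≤ 1 / 2 := le_of_lt (lt_of_lt_of_le hσlt (min_le_right _ _))
  have hT : 0 < T := lt_of_le_of_lt hτ.1 hτ.2
  have E0 := G0 σ hσ hσ0' T ρ θ u hsol hguard Φ hLLN ℓ hℓ hℓ0 hℓ3 τ hτ a b hab φ hφ hφ0
  have E1 := G1 σ hσ hσ1' T ρ θ u hsol hguard Φ hLLN ℓ hℓ hℓ0 hℓ3 τ hτ a b hab φ hφ hφ0
  have E2 : Tendsto (fun N : ℕ => ∫⁻ z, ENNReal.ofReal
      (dynPart σ η₁ T ℓ Φ τ a b φ N z + initPart σ η₁ ℓ Φ a b φ N z)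
        ∂(localGibbsLaw σ a₀ u₀ θ₀ N (Φ N))) atTop (𝓝 0) :=
    G2 σ hσ hσ2' T ρ θ u hsol hguard Φ hLLN ℓ hℓ hℓ0 hℓ3 τ hτ a b hab φ hφ hφ0
  haveI hP : ∀ N, IsProbabilityMeasure (localGibbsLaw σ a₀ u₀ θ₀ N (Φ N)) := fun N =>
    isProbabilityMeasure_localGibbsLaw ha hθ hu ha0 hθ0 hσhalf N (Φ N)
  have hB : ∀ N, Integrable (initPart σ η₁ ℓ Φ a b φ N) (localGibbsLaw σ a₀ u₀ θ₀ N (Φ N)) := fun N =>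
    integrable_initPart hcont hσ.le hη₁.le hη₁E Φ (hℓ N).1 hT hab.le hφ _
  exact eventually_integral_add_const_le (fun N => localGibbsLaw σ a₀ u₀ θ₀ N (Φ N))
    (fun N z => dynPart σ η₁ T ℓ Φ τ a b φ N z) (fun N z => initPart σ η₁ ℓ Φ a b φ N z)
    (initLimit σ η₁ ρ θ a b φ) E1 hB E0 E2

end Summit.AtomisticToContinuum.HydrodynamicLimit.Theorems.EABirthS1bNec

end
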